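import Mathlib
import Summits.KontsevichZagierPeriods.KontsevichZagierPeriods.Theorems.SymplecticScissorsVolumeFormOffPlaneCumprodMove

/-!
# `VolumeFormOffPlane` (stmt-KontsevichZagierPeriods-14935) — line `Sketch`,
helpers for stub `stub_slackMerge` (the slack-merging chart)

Total dimension `N + 2`, coordinates `(b, z, w)` with base `b ∈ ℝ^N`
(`Fin.castSucc ∘ Fin.castSucc`), next-to-last `z` and last `w`; `P(b) = ∏_κ b_{c κ}` a product of
base coordinates. The chart `Φ (b, z, w) = (b, z / P(b), w · P(b))` is `ℚ`-semialgebraic off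
`{P = 0}` (polynomial rows and one quotient), a bijection with inverse
`Ψ (b, z, w) = (b, z · P(b), w / P(b))`, and differentiable with lower-triangular Jacobian of
diagonal `(1, …, 1, 1/P, P)`, hence `det Φ' = 1` (`cpm_det_of_lowerTriangular` of the sibling
`…CumprodMove.lean`). Also: the coordinate permutation `(x, z, y, w) ↦ (x, y, z, w)` between
`Fin ((p + 1) + (q + 1))` and `Fin (p + q + 1 + 1)`.

Sources: M. Kontsevich, D. Zagier, *Periods* (2001), §1.2 rule (2); J. Bochnak, M. Coste,
M.-F. Roy, *Real Algebraic Geometry* (1998), §2.2. The Jacobian bookkeeping is folklore.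
-/

noncomputable section

open MeasureTheory Set MvPolynomial
open Literature.NumberTheory.Transcendental Literature.ModelTheory.ExponentialFields

namespace Summit.KontsevichZagierPeriods.SymplecticScissors.LogPolytope

/-! ## Index bookkeeping -/

/-- The coordinate permutation `(x, z, y, w) ↦ (x, y, z, w)` from the product coordinates
`Fin ((p + 1) + (q + 1))` to the slab coordinates `Fin (p + q + 1 + 1)`, with its values on the
four blocks. [folklore] -/
theorem sm_exists_perm (p q : ℕ) :
    ∃ e : Fin (p + 1 + (q + 1)) ≃ Fin (p + q + 1 + 1),
      (∀ ι : Fin p, e (Fin.castAdd (q + 1) (Fin.castSucc ι)) =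
        Fin.castSucc (Fin.castSucc (Fin.castAdd q ι))) ∧
      e (Fin.castAdd (q + 1) (Fin.last p)) = Fin.castSucc (Fin.last (p + q)) ∧
      (∀ κ : Fin q, e (Fin.natAdd (p + 1) (Fin.castSucc κ)) =
        Fin.castSucc (Fin.castSucc (Fin.natAdd p κ))) ∧
      e (Fin.natAdd (p + 1) (Fin.last q)) = Fin.last (p + q + 1) := by
  refine ⟨⟨Fin.append
      (Fin.snoc (α := fun _ => Fin (p + q + 1 + 1))
        (fun ι : Fin p => Fin.castSucc (Fin.castSucc (Fin.castAdd q ι)))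
        (Fin.castSucc (Fin.last (p + q))))
      (Fin.snoc (α := fun _ => Fin (p + q + 1 + 1))
        (fun κ : Fin q => Fin.castSucc (Fin.castSucc (Fin.natAdd p κ))) (Fin.last (p + q + 1))),
    Fin.snoc (α := fun _ => Fin (p + 1 + (q + 1)))
      (Fin.snoc (α := fun _ => Fin (p + 1 + (q + 1)))
        (Fin.append (fun ι : Fin p => Fin.castAdd (q + 1) (Fin.castSucc ι))
          (fun κ : Fin q => Fin.natAdd (p + 1) (Fin.castSucc κ)))
        (Fin.castAdd (q + 1) (Fin.last p)))
      (Fin.natAdd (p + 1) (Fin.last q)), ?_, ?_⟩, ?_, ?_, ?_, ?_⟩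
  · intro k
    induction k using Fin.addCases with
    | left i =>
      induction i using Fin.lastCases with
      | last => simp only [Fin.append_left, Fin.snoc_castSucc, Fin.snoc_last]
      | cast ι => simp only [Fin.append_left, Fin.snoc_castSucc]
    | right j =>
      induction j using Fin.lastCases with
      | last => simp only [Fin.append_right, Fin.snoc_last]
      | cast κ => simp only [Fin.append_right, Fin.snoc_castSucc]
  · intro k
    induction k using Fin.lastCases with
    | last => simp only [Fin.append_right, Fin.snoc_last]
    | cast k =>
      induction k using Fin.lastCases with
      | last => simp only [Fin.append_left, Fin.snoc_castSucc, Fin.snoc_last]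
      | cast j =>
        induction j using Fin.addCases with
        | left ι => simp only [Fin.append_left, Fin.snoc_castSucc]
        | right κ => simp only [Fin.append_right, Fin.snoc_castSucc]
  · intro ι
    simp only [Equiv.coe_fn_mk, Fin.append_left, Fin.snoc_castSucc]
  · simp only [Equiv.coe_fn_mk, Fin.append_left, Fin.snoc_last]
  · intro κ
    simp only [Equiv.coe_fn_mk, Fin.append_right, Fin.snoc_castSucc]
  · simp only [Equiv.coe_fn_mk, Fin.append_right, Fin.snoc_last]

/-- Extensionality of vectors of `ℝ^{N+2}` along the splitting base / next-to-last / last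
coordinate. [folklore] -/
theorem sm_ext {N : ℕ} {α : Type*} {u v : Fin (N + 1 + 1) → α}
    (hb : ∀ j : Fin N, u (Fin.castSucc (Fin.castSucc j)) = v (Fin.castSucc (Fin.castSucc j)))
    (hz : u (Fin.castSucc (Fin.last N)) = v (Fin.castSucc (Fin.last N)))
    (hw : u (Fin.last (N + 1)) = v (Fin.last (N + 1))) : u = v := by
  funext i
  cases i using Fin.lastCases with
  | last => exact hw
  | cast i =>
    cases i using Fin.lastCases with
    | last => exact hz
    | cast j => exact hb j

/-! ## The slack-merging chart `Φ (b, z, w) = (b, z / P, w · P)` -/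

/-- The chart `Φ (b, z, w) = (b, z / P(b), w · P(b))` and the chart `Ψ` with `P` and `P⁻¹`
exchanged preserve `P` (a product of base coordinates) and are mutually inverse off `{P = 0}`.
[folklore] -/
theorem sm_inverse {N q : ℕ} (c : Fin q → Fin N) (P : (Fin (N + 1 + 1) → ℝ) → ℝ)
    (hP : ∀ v, P v = ∏ κ, v (Fin.castSucc (Fin.castSucc (c κ))))
    (Φ Ψ : (Fin (N + 1 + 1) → ℝ) → (Fin (N + 1 + 1) → ℝ))
    (hΦb : ∀ v (j : Fin N),
      Φ v (Fin.castSucc (Fin.castSucc j)) = v (Fin.castSucc (Fin.castSucc j)))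
    (hΦz : ∀ v, Φ v (Fin.castSucc (Fin.last N)) = v (Fin.castSucc (Fin.last N)) * (P v)⁻¹)
    (hΦw : ∀ v, Φ v (Fin.last (N + 1)) = v (Fin.last (N + 1)) * P v)
    (hΨb : ∀ v (j : Fin N),
      Ψ v (Fin.castSucc (Fin.castSucc j)) = v (Fin.castSucc (Fin.castSucc j)))
    (hΨz : ∀ v, Ψ v (Fin.castSucc (Fin.last N)) = v (Fin.castSucc (Fin.last N)) * P v)
    (hΨw : ∀ v, Ψ v (Fin.last (N + 1)) = v (Fin.last (N + 1)) * (P v)⁻¹) :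
    (∀ v, P (Φ v) = P v) ∧ (∀ v, P (Ψ v) = P v) ∧
      (∀ v, P v ≠ 0 → Ψ (Φ v) = v) ∧ (∀ v, P v ≠ 0 → Φ (Ψ v) = v) := by
  have hPΦ : ∀ v, P (Φ v) = P v := fun v => by simp only [hP, hΦb]
  have hPΨ : ∀ v, P (Ψ v) = P v := fun v => by simp only [hP, hΨb]
  refine ⟨hPΦ, hPΨ, fun v hv => sm_ext (fun j => by rw [hΨb, hΦb]) ?_ ?_,
    fun v hv => sm_ext (fun j => by rw [hΦb, hΨb]) ?_ ?_⟩
  · rw [hΨz, hPΦ, hΦz, inv_mul_cancel_right₀ hv]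
  · rw [hΨw, hPΦ, hΦw, mul_inv_cancel_right₀ hv]
  · rw [hΦz, hPΨ, hΨz, mul_inv_cancel_right₀ hv]
  · rw [hΦw, hPΨ, hΨw, inv_mul_cancel_right₀ hv]

/-- The chart `Φ (b, z, w) = (b, z / P(b), w · P(b))` is `ℚ`-semialgebraic on every
`ℚ`-semialgebraic set off `{P = 0}`: its rows are polynomials and one quotient of polynomials
with non-vanishing denominator. [cite: BochnakCosteRoy1998, §2.2] -/
theorem sm_isSemialgebraicMapOn {N q : ℕ} (c : Fin q → Fin N) (P : (Fin (N + 1 + 1) → ℝ) → ℝ)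
    (hP : ∀ v, P v = ∏ κ, v (Fin.castSucc (Fin.castSucc (c κ))))
    (Φ : (Fin (N + 1 + 1) → ℝ) → (Fin (N + 1 + 1) → ℝ))
    (hΦb : ∀ v (j : Fin N),
      Φ v (Fin.castSucc (Fin.castSucc j)) = v (Fin.castSucc (Fin.castSucc j)))
    (hΦz : ∀ v, Φ v (Fin.castSucc (Fin.last N)) = v (Fin.castSucc (Fin.last N)) * (P v)⁻¹)
    (hΦw : ∀ v, Φ v (Fin.last (N + 1)) = v (Fin.last (N + 1)) * P v)
    {σ : Set (Fin (N + 1 + 1) → ℝ)} (hσ : IsSemialgebraic ℚ σ) (h0 : ∀ v ∈ σ, P v ≠ 0) :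
    IsSemialgebraicMapOn ℚ σ Φ := by
  classical
  refine IsSemialgebraicMapOn.of_forall hσ fun i => ?_
  cases i using Fin.lastCases with
  | last =>
    exact (isSemialgebraicFunOn_aeval hσ (X (Fin.last (N + 1)) *
      ∏ κ, (X (Fin.castSucc (Fin.castSucc (c κ))) : MvPolynomial (Fin (N + 1 + 1)) ℚ))).congr
        fun v _ => by simp only [map_mul, map_prod, aeval_X, hΦw, hP]
  | cast i =>
    cases i using Fin.lastCases with
    | last =>
      have hq : ∀ v ∈ σ, aeval v (∏ κ, (X (Fin.castSucc (Fin.castSucc (c κ))) :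
          MvPolynomial (Fin (N + 1 + 1)) ℚ)) ≠ (0 : ℝ) := fun v hv => by
        simp only [map_prod, aeval_X, ← hP v]
        exact h0 v hv
      exact (isSemialgebraicFunOn_aeval_div_aeval hσ (X (Fin.castSucc (Fin.last N))) _ hq).congr
        fun v _ => by simp only [map_prod, aeval_X, hΦz, hP, div_eq_mul_inv]
    | cast j =>
      exact (isSemialgebraicFunOn_aeval hσ
        (X (Fin.castSucc (Fin.castSucc j)) : MvPolynomial (Fin (N + 1 + 1)) ℚ)).congr
          fun v _ => by simp only [aeval_X, hΦb]

/-- **Derivative and Jacobian determinant of the slack-merging chart.** Off `{P = 0}` the chart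
`Φ (b, z, w) = (b, z / P(b), w · P(b))` (`P` a product of base coordinates) is differentiable, and
its derivative — lower triangular with diagonal `(1, …, 1, 1/P, P)` — has determinant `1`.
[folklore] -/
theorem sm_hasFDerivAt : ∀ {N q : ℕ} (c : Fin q → Fin N) (P : (Fin (N + 1 + 1) → ℝ) → ℝ), (∀ v, P v = ∏ κ, v (Fin.castSucc (Fin.castSucc (c κ)))) → ∀ (Φ : (Fin (N + 1 + 1) → ℝ) → (Fin (N + 1 + 1) → ℝ)), (∀ v (j : Fin N), Φ v (Fin.castSucc (Fin.castSucc j)) = v (Fin.castSucc (Fin.castSucc j))) → (∀ v, Φ v (Fin.castSucc (Fin.last N)) = v (Fin.castSucc (Fin.last N)) * (P v)⁻¹) → (∀ v, Φ v (Fin.last (N + 1)) = v (Fin.last (N + 1)) * P v) → ∃ Φ' : (Fin (N + 1 + 1) → ℝ) → (Fin (N + 1 + 1) → ℝ) →L[ℝ] (Fin (N + 1 + 1) → ℝ), ∀ v, P v ≠ 0 → HasFDerivAt Φ (Φ' v) v ∧ (Φ' v).det = 1 := by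
  intro N q c P hP Φ hΦb hΦz hΦw
  classical
  -- the projection to the `y`-coordinates and the product `G` of all coordinates of `ℝ^q`
  obtain ⟨πy, hπy⟩ : ∃ πy : (Fin (N + 1 + 1) → ℝ) →L[ℝ] (Fin q → ℝ),
      ∀ v κ, πy v κ = v (Fin.castSucc (Fin.castSucc (c κ))) :=
    ⟨ContinuousLinearMap.pi fun κ => ContinuousLinearMap.proj (R := ℝ)
      (φ := fun _ : Fin (N + 1 + 1) => ℝ) (Fin.castSucc (Fin.castSucc (c κ))), fun _ _ => rfl⟩
  obtain ⟨G, hG, hGd⟩ : ∃ G : (Fin q → ℝ) → ℝ,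
      (∀ y, G y = ∏ κ, y κ) ∧ ∀ y, DifferentiableAt ℝ G y :=
    ⟨fun y => ∏ κ, y κ, fun _ => rfl, fun y =>
      (hasFDerivAt_finsetProd (𝕜 := ℝ) (u := Finset.univ) (x := y)).differentiableAt⟩
  have hPG : ∀ v, P v = G (πy v) := fun v => by
    rw [hP, hG]
    simp only [hπy]
  have hπz : πy (Pi.single (Fin.castSucc (Fin.last N)) (1 : ℝ)) = 0 := funext fun κ => by
    rw [hπy, Pi.zero_apply]
    exact Pi.single_eq_of_ne
      (fun h => (Fin.castSucc_lt_last (c κ)).ne (Fin.castSucc_injective _ h)) _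
  have hπw : πy (Pi.single (Fin.last (N + 1)) (1 : ℝ)) = 0 := funext fun κ => by
    rw [hπy, Pi.zero_apply]
    exact Pi.single_eq_of_ne (Fin.castSucc_lt_last _).ne _
  -- the two non-trivial rows of the Jacobian
  obtain ⟨Lz, hLz⟩ : ∃ Lz : (Fin (N + 1 + 1) → ℝ) → (Fin (N + 1 + 1) → ℝ) →L[ℝ] ℝ,
      ∀ v, Lz v = v (Fin.castSucc (Fin.last N)) • (fderiv ℝ (fun y => (G y)⁻¹) (πy v)).comp πy +
        (G (πy v))⁻¹ • ContinuousLinearMap.proj (R := ℝ) (φ := fun _ : Fin (N + 1 + 1) => ℝ)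
          (Fin.castSucc (Fin.last N)) := ⟨_, fun _ => rfl⟩
  obtain ⟨Lw, hLw⟩ : ∃ Lw : (Fin (N + 1 + 1) → ℝ) → (Fin (N + 1 + 1) → ℝ) →L[ℝ] ℝ,
      ∀ v, Lw v = v (Fin.last (N + 1)) • (fderiv ℝ G (πy v)).comp πy +
        G (πy v) • ContinuousLinearMap.proj (R := ℝ) (φ := fun _ : Fin (N + 1 + 1) => ℝ)
          (Fin.last (N + 1)) := ⟨_, fun _ => rfl⟩
  refine ⟨fun v => ContinuousLinearMap.pi
    (Fin.snoc (α := fun _ : Fin (N + 1 + 1) => (Fin (N + 1 + 1) → ℝ) →L[ℝ] ℝ)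
      (Fin.snoc (α := fun _ : Fin (N + 1) => (Fin (N + 1 + 1) → ℝ) →L[ℝ] ℝ)
        (fun j => ContinuousLinearMap.proj (R := ℝ) (φ := fun _ : Fin (N + 1 + 1) => ℝ)
          (Fin.castSucc (Fin.castSucc j))) (Lz v)) (Lw v)), fun v hv => ?_⟩
  have hG0 : G (πy v) ≠ 0 := by
    rw [← hPG]
    exact hv
  beta_reduce
  constructor
  · refine hasFDerivAt_pi'' fun i => ?_
    rw [ContinuousLinearMap.proj_pi]
    cases i using Fin.lastCases with
    | last =>
      rw [Fin.snoc_last, hLw, show (fun x => Φ x (Fin.last (N + 1))) =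
        fun x => x (Fin.last (N + 1)) * (G ∘ πy) x from
          funext fun x => by simp only [hΦw, hPG, Function.comp_apply]]
      exact (hasFDerivAt_apply (Fin.last (N + 1)) v).fun_mul
        ((hGd (πy v)).hasFDerivAt.comp v πy.hasFDerivAt)
    | cast i =>
      rw [Fin.snoc_castSucc]
      cases i using Fin.lastCases with
      | last =>
        rw [Fin.snoc_last, hLz, show (fun x => Φ x (Fin.castSucc (Fin.last N))) =
          fun x => x (Fin.castSucc (Fin.last N)) * ((fun y => (G y)⁻¹) ∘ πy) x from
            funext fun x => by simp only [hΦz, hPG, Function.comp_apply]]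
        exact (hasFDerivAt_apply (Fin.castSucc (Fin.last N)) v).fun_mul
          (((hGd (πy v)).fun_inv hG0).hasFDerivAt.comp v πy.hasFDerivAt)
      | cast j =>
        rw [Fin.snoc_castSucc, show (fun x => Φ x (Fin.castSucc (Fin.castSucc j))) =
          fun x => x (Fin.castSucc (Fin.castSucc j)) from funext fun x => hΦb x j]
        exact hasFDerivAt_apply _ v
  · have htri : ∀ i j : Fin (N + 1 + 1), i < j → ContinuousLinearMap.pi
        (Fin.snoc (α := fun _ : Fin (N + 1 + 1) => (Fin (N + 1 + 1) → ℝ) →L[ℝ] ℝ)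
          (Fin.snoc (α := fun _ : Fin (N + 1) => (Fin (N + 1 + 1) → ℝ) →L[ℝ] ℝ)
            (fun j => ContinuousLinearMap.proj (R := ℝ) (φ := fun _ : Fin (N + 1 + 1) => ℝ)
              (Fin.castSucc (Fin.castSucc j))) (Lz v)) (Lw v)) (Pi.single j 1) i = 0 := by
      intro i j hij
      rw [ContinuousLinearMap.pi_apply]
      cases i using Fin.lastCases with
      | last => exact absurd (Fin.le_last j) (not_le.mpr hij)
      | cast i =>
        rw [Fin.snoc_castSucc]
        cases i using Fin.lastCases with
        | last =>
          cases j using Fin.lastCases with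
          | cast j =>
            exact absurd (Fin.castSucc_lt_castSucc_iff.mp hij) (not_lt.mpr (Fin.le_last j))
          | last =>
            rw [Fin.snoc_last, hLz]
            simp only [_root_.add_apply, _root_.smul_apply, ContinuousLinearMap.comp_apply,
              hπw, map_zero, smul_zero, zero_add, ContinuousLinearMap.proj_apply,
              Pi.single_eq_of_ne (Fin.castSucc_lt_last (Fin.last N)).ne]
        | cast j₀ =>
          rw [Fin.snoc_castSucc, ContinuousLinearMap.proj_apply]
          exact Pi.single_eq_of_ne hij.ne _
    rw [cpm_det_of_lowerTriangular _ htri, Fin.prod_univ_castSucc, Fin.prod_univ_castSucc]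
    simp only [ContinuousLinearMap.pi_apply, Fin.snoc_castSucc, Fin.snoc_last,
      ContinuousLinearMap.proj_apply, Pi.single_eq_same, Finset.prod_const_one, one_mul]
    simp only [hLz, hLw, _root_.add_apply, _root_.smul_apply, ContinuousLinearMap.comp_apply,
      hπz, hπw, map_zero, smul_eq_mul, mul_zero, zero_add, ContinuousLinearMap.proj_apply,
      Pi.single_eq_same, mul_one]
    exact inv_mul_cancel₀ hG0

end Summit.KontsevichZagierPeriods.SymplecticScissors.LogPolytope

end
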